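import Mathlib
import HarnessLib

/-!
# Transition probabilities of symmetric stable-like jump chains on `ℤ^d` (Bass–Levin 2002)

Topic `Probability/Process`. The discrete-time symmetric Markov chain on `ℤ^d` with conductances
`C x y = C y x > 0` (`x ≠ y`), `C x x = 0`, `∑_z C x z < ∞`, and one-step law
`P(X₁ = y | X₀ = x) = C x y / ∑_z C x z` (Bass–Levin eq. (1.1)), under the stable-like
comparability `κ⁻¹ |x−y|^{-(d+α)} ≤ C x y ≤ κ |x−y|^{-(d+α)}`, `α ∈ (0,2)` (eq. (1.2)).

* `jumpChainProb C n x y` — `p(n,x,y) = P_x(X_n = y)`, defined by the Chapman–Kolmogorov recursion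
  `p(0,x,y) = 𝟙{x=y}`, `p(n+1,x,y) = ∑_z p(n,x,z) · C z y / ∑_w C z w`.
* `heatKernelShape d α n x y` — the comparison function `n^{-d/α} ∧ n/|x−y|^{d+α}` of (1.3)–(1.4)
  (with the convention that the second term is `+∞`, i.e. absent, when `x = y`).
* `bassLevin_thm_1_1` — NAMED FACT, Bass–Levin Thm 1.1: two-sided bounds
  `c₂ (n^{-d/α} ∧ n|x−y|^{-(d+α)}) ≤ p(n,x,y) ≤ c₁ (n^{-d/α} ∧ n|x−y|^{-(d+α)})`
  (upper bound for all `n ≥ 1`; lower bound for `n ≥ 2`, and for `n = 1` when `x ≠ y`).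

Norms: the paper's `|x−y|` is the Euclidean norm on `ℤ^d`; we write `‖x−y‖` for the sup norm of
`Fin d → ℤ` (the norm used by `Literature.Probability.LatticeModels.IsPowerBounded`). Since all norms
on `ℤ^d ⊂ ℝ^d` are comparable, hypothesis (1.2) and conclusions (1.3)–(1.4) define the same classes
of conductances / bounds (only `κ, c₁, c₂` change), so the statement below is equivalent to the
printed one. Grounds the transfer step of
`Summit.CriticalPhenomena.Ising3DConformalLimit.Theses.PrecisionLaplacian.EtaBoundsTransfer`
(conductances `a(y−x) ≍ |x−y|^{-(3+α)}`, `α = 2−η`; the Green-function bound `∑_n p(n,x,y) ≍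
|x−y|^{α−d}` for `d > α` is a corollary by summation and is NOT stated in the paper, hence not here).

## References
* R. F. Bass, D. A. Levin, *Transition probabilities for symmetric jump processes*,
  Trans. Amer. Math. Soc. 354 (2002) 2933–2953, §1 eqs. (1.1)–(1.4), Theorem 1.1 (p. 2933–2934).
-/

noncomputable section

namespace Literature.Probability.Process

open scoped BigOperators

/-- `p(n,x,y) = P_x(X_n = y)` for the discrete-time Markov chain on `ℤ^d` with one-step transition
probabilities `C x y / ∑_z C x z` (Bass–Levin eq. (1.1)), via the Chapman–Kolmogorov recursion.
[cite: BassLevin2002, §1 eq. (1.1)] -/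
def jumpChainProb {d : ℕ} (C : (Fin d → ℤ) → (Fin d → ℤ) → ℝ) : ℕ → (Fin d → ℤ) → (Fin d → ℤ) → ℝ
  | 0, x, y => if x = y then 1 else 0
  | n + 1, x, y => ∑' z : Fin d → ℤ, jumpChainProb C n x z * (C z y / ∑' w : Fin d → ℤ, C z w)

/-- The comparison shape `n^{-d/α} ∧ n / |x−y|^{d+α}` of Bass–Levin (1.3)–(1.4); for `x = y` the
second term is `+∞` in the paper, i.e. the shape is `n^{-d/α}`. [cite: BassLevin2002, Thm 1.1] -/
def heatKernelShape (d : ℕ) (α : ℝ) (n : ℕ) (x y : Fin d → ℤ) : ℝ :=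
  if x = y then (n : ℝ) ^ (-(d : ℝ) / α)
  else min ((n : ℝ) ^ (-(d : ℝ) / α)) ((n : ℝ) / ‖x - y‖ ^ ((d : ℝ) + α))

/-- NAMED FACT — **Bass–Levin 2002, Theorem 1.1.** Let `α ∈ (0,2)`, `d ≥ 1`, and let `C x y`
(`x ≠ y ∈ ℤ^d`) be positive finite symmetric conductances with `C x x = 0`, `∑_z C x z < ∞` and
`κ⁻¹ |x−y|^{-(d+α)} ≤ C x y ≤ κ |x−y|^{-(d+α)}` for some `κ > 1` (eq. (1.2)). Write `p(n,x,y) =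
P_x(X_n = y)` for the chain (1.1). "There exist positive finite constants `c₁` and `c₂` such that
`p(n,x,y) ≤ c₁ (n^{-d/α} ∧ n/|x−y|^{d+α})` (1.3), and for `n ≥ 2`,
`p(n,x,y) ≥ c₂ (n^{-d/α} ∧ n/|x−y|^{d+α})` (1.4). If `n = 1` and `x ≠ y`, (1.4) also holds."
(Sup norm instead of the Euclidean norm — equivalent statement, see the module docstring.)
[cite: BassLevin2002, Thm 1.1] -/
def bassLevin_thm_1_1 : Prop :=
  ∀ (d : ℕ) (α κ : ℝ) (C : (Fin d → ℤ) → (Fin d → ℤ) → ℝ), 1 ≤ d → 0 < α → α < 2 → 1 < κ →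
    (∀ x, C x x = 0) → (∀ x y, C x y = C y x) → (∀ x, Summable (C x)) →
    (∀ x y, x ≠ y →
      κ⁻¹ * ‖x - y‖ ^ (-((d : ℝ) + α)) ≤ C x y ∧ C x y ≤ κ * ‖x - y‖ ^ (-((d : ℝ) + α))) →
    ∃ c₁ c₂ : ℝ, 0 < c₁ ∧ 0 < c₂ ∧
      (∀ (n : ℕ) (x y : Fin d → ℤ), 1 ≤ n →
        jumpChainProb C n x y ≤ c₁ * heatKernelShape d α n x y) ∧
      (∀ (n : ℕ) (x y : Fin d → ℤ), (2 ≤ n ∨ (n = 1 ∧ x ≠ y)) →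
        c₂ * heatKernelShape d α n x y ≤ jumpChainProb C n x y)

end Literature.Probability.Process
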